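import Summits.ResolutionOfSingularities.ResolutionOfSingularities.Theorems.FrobeniusLadderFInjectiveMacaulayficationLx6c3PointFloorCharts
import Summits.ResolutionOfSingularities.ResolutionOfSingularities.Theorems.FrobeniusLadderFInjectiveMacaulayficationLx6q7PointFloor
import Summits.ResolutionOfSingularities.ResolutionOfSingularities.Theorems.FrobeniusLadderFInjectiveMacaulayficationTauFloorInputLegal
import Summits.ResolutionOfSingularities.ResolutionOfSingularities.Theorems.FrobeniusLadderFInjectiveMacaulayficationIntrinsicTowerRecipes
import HarnessLib

/-!
# (NEG-0) THE FLOOR PACKAGE FOR THE NEG-N BED d4lx6c3: the point floor `S′ = Bl_𝔪 X → Spec 𝒪_{X,0}` is an ADMISSIBLE CM floor, NOT FULL, and meets the binders of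
# `TowerTerminates` / the F-half BY NAME
# (crux `FInjectiveMacaulayfication` stmt-ResolutionOfSingularities-15315, chain w45a; res-L1-w45a-plan-1 g19 RULINGs R19.21/R19.22 PROGRAMME «NEG-N», piece (NEG-0) = floor 1 of
# the N-tower is admissible; seat res-L1-w45a-stub-3 g10; twin of `Lx6q7PointFloor` / `Lx6c5PointFloor`)

[OURS · L1 W4.5a] Support file (`--supports stmt-ResolutionOfSingularities-15315 --as helper`); def-free; §1–§2 UNCONDITIONAL; §3 instantiates the CANDIDATE statements
`IntrinsicTower.Recipes.TowerTerminates c` / `LocalFullificationFibreAdmGe4Split.LocalFInjectivizationFibreAdmGe4` taken as HYPOTHESES (nothing asserted about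
them). Replaces the role of NO printed item; NOT a statement of the manuscript; AI-written (AI review is weaker than expert review).

WHAT. `X = Spec A₀`, `A₀ = k[x,y,u,t,z]/(z² + x⁶z + y³ + u³ + t³)`, `char k = 2` (any field), `v` = the origin, `𝔪 = (x̄,ȳ,ū,t̄,z̄) = 𝔪_v`,
`I := 𝔪̃|_{Spec 𝒪_{X,v}}` — the POINT FLOOR = floor 1 of the N-tower of PROGRAMME «NEG-N» (tri-2's replay: the `nonFullCentre` tower from it returns to the
floor-5 germ with period one; lead-1's `…NonFullLoopFrame` §5 consumes `hfloor = NEG-0 ∘ NEG-T`).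
For EVERY blowing up `g : S′ → Spec 𝒪_{X,v}` along `I`:
* §1 ★★ `pointFloor_lx6c3_input_legal` — `I ≠ ⊥` ∧ `Supp I ⊆ (Reg Spec 𝒪_{X,v})ᶜ` ∧ `S′` regular off the closed fibre ∧ `S′` CM at every stalk (the five charts of `Bl_𝔪 X`
  are hypersurfaces, `Lx6c3PointFloorCharts.cmCl_stalk_affineBlowup`; glue = res-L1-w45a-stub-1's `TauFloorInputLegal.offFibre_regular_and_cmCl`).
* §2 ★★ `pointFloor_lx6c3_not_full` — some stalk of `S′` over the closed point is NOT FULL (the origin of `D(x̄)`, Fedder), so `RecipeTowerFull c 2 0 S′` fails for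
  every recipe: the tower has positive height at this floor.
* §3 ★ `recipeTowerFull_of_towerTerminates` — BY NAME: `TowerTerminates c → ∃ n, RecipeTowerFull c 2 n S′` at this floor (all binders of `TowerTerminates` at
  `(d,p) = (4,2)` discharged: separated / finite type / quasi-compact / integral / `v` closed, singular, `dim 𝒪_{X,v} = 4` / §1); in particular for the statement
  OF RECORD `TauTowerConjecture` (`tauCentre`): a loop or a never-FULL rad-τ tower on `S′` refutes it. ★ `fHalf_at_pointFloor` — the F-half instantiated likewise.
[folklore assembly; cite: GortzWedhorn2020, Prop. 13.91 (2), (13.19)] [cite: StacksProject, Tag 0804; Tag 02OS; Tag 01J7] [cite: Temkin2008, §2.1] [cite: Fedder1983, Prop. 1.7]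
-/

-- single-problem summit: the doubled namespace component is forced
set_option linter.dupNamespace false

noncomputable section

namespace Summit.ResolutionOfSingularities.ResolutionOfSingularities.Theorems.FInjectiveMacaulayfication.Lx6c3PointFloor

open CategoryTheory CategoryTheory.Limits AlgebraicGeometry TopologicalSpace IsLocalRing MvPolynomial
open Literature.AlgebraicGeometry.Resolution
open Summit.ResolutionOfSingularities.ResolutionOfSingularities.Theorems.FInjectiveMacaulayfication
open SliceableCentre GermOfGlobalBlowup

/-! ## §1 The point floor is a legal (admissible, CM) floor -/

/-- `x̄ ≠ 0` in `A₀` (`f ∤ X0`: `f(1,0,0,0,0) = 0`). [folklore] -/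
theorem mk_X_zero_ne_zero (k : Type) [Field k] (f : MvPolynomial (Fin 5) k) (hf : f = X 4 ^ 2 + X 0 ^ 6 * X 4 + X 1 ^ 3 + X 2 ^ 3 + X 3 ^ 3) : Ideal.Quotient.mk (Ideal.span {f}) (X 0) ≠ 0 := by
  intro h
  rw [Ideal.Quotient.eq_zero_iff_mem, Ideal.mem_span_singleton] at h
  obtain ⟨c, hc⟩ := h
  have := congrArg (MvPolynomial.eval (Pi.single 0 1 : Fin 5 → k)) hc
  rw [hf] at this
  simp at this

/-- ★★ **THE POINT FLOOR OF d4lx6c3 IS A LEGAL INPUT** of `TowerTerminates` / the F-half: for every blowing up `g : S′ → Spec 𝒪_{X,v}` along `I = 𝔪̃|_{Spec 𝒪_{X,v}}`: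
(1) `I ≠ ⊥`; (2) `Supp I ⊆ (Reg Spec 𝒪_{X,v})ᶜ`; (3) `S′` is regular off the closed fibre; (4) `S′` satisfies the CM clause at every point.
[folklore assembly; cite: GortzWedhorn2020, Prop. 13.91 (2)] [cite: StacksProject, Tag 02OS; Tag 01J7] [cite: Temkin2008, §2.1] -/
theorem pointFloor_lx6c3_input_legal (k : Type) [Field k] [CharP k 2] (f : MvPolynomial (Fin 5) k) (hf : f = X 4 ^ 2 + X 0 ^ 6 * X 4 + X 1 ^ 3 + X 2 ^ 3 + X 3 ^ 3)
    (v : Spec (.of (MvPolynomial (Fin 5) k ⧸ Ideal.span {f})))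
    (hv : v.asIdeal = Ideal.span (Set.range (fun j : Fin 5 => Ideal.Quotient.mk (Ideal.span {f}) (X j))))
    (S' : Scheme.{0}) (g : S' ⟶ Spec ((Spec (.of (MvPolynomial (Fin 5) k ⧸ Ideal.span {f}))).presheaf.stalk v))
    (hg : IsBlowup g ((affineBlowup.idealSheaf (Ideal.span (Set.range (fun j : Fin 5 => Ideal.Quotient.mk (Ideal.span {f}) (X j))))).comap ((Spec (.of (MvPolynomial (Fin 5) k ⧸ Ideal.span {f}))).fromSpecStalk v))) :
    ((affineBlowup.idealSheaf (Ideal.span (Set.range (fun j : Fin 5 => Ideal.Quotient.mk (Ideal.span {f}) (X j))))).comap ((Spec (.of (MvPolynomial (Fin 5) k ⧸ Ideal.span {f}))).fromSpecStalk v)) ≠ ⊥ ∧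
    (((((affineBlowup.idealSheaf (Ideal.span (Set.range (fun j : Fin 5 => Ideal.Quotient.mk (Ideal.span {f}) (X j))))).comap ((Spec (.of (MvPolynomial (Fin 5) k ⧸ Ideal.span {f}))).fromSpecStalk v))).support : Set (Spec ((Spec (.of (MvPolynomial (Fin 5) k ⧸ Ideal.span {f}))).presheaf.stalk v))) ⊆ (Scheme.regularLocus (Spec ((Spec (.of (MvPolynomial (Fin 5) k ⧸ Ideal.span {f}))).presheaf.stalk v)))ᶜ) ∧
    (∀ s : S', g.base s ≠ closedPoint ((Spec (.of (MvPolynomial (Fin 5) k ⧸ Ideal.span {f}))).presheaf.stalk v) → s ∈ Scheme.regularLocus S') ∧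
    (∀ s : S', CMCl (S'.presheaf.stalk s)) := by
  classical
  haveI := Lx6c3Specimen.isIntegral_lx6c3 k f hf
  have h𝔪0 : (Ideal.span (Set.range (fun j : Fin 5 => Ideal.Quotient.mk (Ideal.span {f}) (X j)))) ≠ ⊥ := by
    intro h0
    have hmem : Ideal.Quotient.mk (Ideal.span {f}) (X 0) ∈ (Ideal.span (Set.range (fun j : Fin 5 => Ideal.Quotient.mk (Ideal.span {f}) (X j)))) := Ideal.subset_span ⟨0, rfl⟩
    rw [h0, Ideal.mem_bot] at hmem
    exact mk_X_zero_ne_zero k f hf hmem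
  have hsupp := Lx6q7PointFloor.support_specializes k f v hv
  have h34 := TauFloorInputLegal.offFibre_regular_and_cmCl v (affineBlowup.isBlowup _) hsupp (Lx6c3Specimen.regular_of_ne_vertex k f hf v hv)
    (Lx6c3PointFloorCharts.cmCl_stalk_affineBlowup k f hf) hg
  exact ⟨comap_fromSpecStalk_ne_bot (affineBlowup.idealSheaf_ne_bot h𝔪0) v,
    TauFloorInputLegal.support_comap_subset_compl_regularLocus v _ hsupp (Lx6c3Specimen.vertex_not_mem_regularLocus k f hf v hv), h34.1, h34.2⟩

/-! ## §2 The point floor is NOT FULL -/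

/-- ★★ **THE POINT FLOOR OF d4lx6c3 IS NOT FULL**: for every blowing up `g : S′ → Spec 𝒪_{X,v}` along `I` there is a point `s ∈ S′` over the closed point whose local ring
is NOT FULL (the origin of the chart `D(x̄)`, `Lx6c3PointFloorCharts.exists_point_over_vertex_not_fullCl`). [OURS · assembly; cite: GortzWedhorn2020, Prop. 13.91 (2)] -/
theorem pointFloor_lx6c3_not_full (k : Type) [Field k] [CharP k 2] (f : MvPolynomial (Fin 5) k) (hf : f = X 4 ^ 2 + X 0 ^ 6 * X 4 + X 1 ^ 3 + X 2 ^ 3 + X 3 ^ 3)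
    (v : Spec (.of (MvPolynomial (Fin 5) k ⧸ Ideal.span {f})))
    (hv : v.asIdeal = Ideal.span (Set.range (fun j : Fin 5 => Ideal.Quotient.mk (Ideal.span {f}) (X j))))
    (S' : Scheme.{0}) (g : S' ⟶ Spec ((Spec (.of (MvPolynomial (Fin 5) k ⧸ Ideal.span {f}))).presheaf.stalk v))
    (hg : IsBlowup g ((affineBlowup.idealSheaf (Ideal.span (Set.range (fun j : Fin 5 => Ideal.Quotient.mk (Ideal.span {f}) (X j))))).comap ((Spec (.of (MvPolynomial (Fin 5) k ⧸ Ideal.span {f}))).fromSpecStalk v))) :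
    ∃ s : S', g.base s = closedPoint ((Spec (.of (MvPolynomial (Fin 5) k ⧸ Ideal.span {f}))).presheaf.stalk v) ∧ ¬ FullCl 2 (S'.presheaf.stalk s) :=
  TauFloorInputNotFull.exists_not_fullCl_of_isBlowup_comap_fromSpecStalk 2 v (affineBlowup.isBlowup _)
    (Lx6c3PointFloorCharts.exists_point_over_vertex_not_fullCl k f hf v hv) hg

/-- Hence no recipe tower of height `0` from this floor: `¬ RecipeTowerFull c 2 0 S′`. [OURS] -/
theorem not_recipeTowerFull_zero (c : IntrinsicTower.Recipes.CentreRecipe) (k : Type) [Field k] [CharP k 2] (f : MvPolynomial (Fin 5) k) (hf : f = X 4 ^ 2 + X 0 ^ 6 * X 4 + X 1 ^ 3 + X 2 ^ 3 + X 3 ^ 3)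
    (v : Spec (.of (MvPolynomial (Fin 5) k ⧸ Ideal.span {f})))
    (hv : v.asIdeal = Ideal.span (Set.range (fun j : Fin 5 => Ideal.Quotient.mk (Ideal.span {f}) (X j))))
    (S' : Scheme.{0}) (g : S' ⟶ Spec ((Spec (.of (MvPolynomial (Fin 5) k ⧸ Ideal.span {f}))).presheaf.stalk v))
    (hg : IsBlowup g ((affineBlowup.idealSheaf (Ideal.span (Set.range (fun j : Fin 5 => Ideal.Quotient.mk (Ideal.span {f}) (X j))))).comap ((Spec (.of (MvPolynomial (Fin 5) k ⧸ Ideal.span {f}))).fromSpecStalk v))) :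
    ¬ IntrinsicTower.Recipes.RecipeTowerFull c 2 0 S' := by
  intro h0
  obtain ⟨s, -, hs⟩ := pointFloor_lx6c3_not_full k f hf v hv S' g hg
  exact hs (IntrinsicTower.Recipes.recipeTowerFull_zero.mp h0 s)

/-! ## §3 The binders of `TowerTerminates` and of the F-half are met at this floor, BY NAME -/

/-- ★ **`TowerTerminates c`, instantiated at the point floor of d4lx6c3** (the candidate taken as a hypothesis; all its binders discharged at `(d,p) = (4,2)`): the
`c`-tower from `S′` terminates at some height `n` (`≥ 1` by §2). For `c = nonFullCentre` this is the N-variant (`NonFullTowerConjecture`) at the NEG-N floor; for `c = tauCentre` it is `TauTowerConjecture` there.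
[OURS · instantiation of a candidate statement] -/
theorem recipeTowerFull_of_towerTerminates (c : IntrinsicTower.Recipes.CentreRecipe) (hTT : IntrinsicTower.Recipes.TowerTerminates c)
    (k : Type) [Field k] [CharP k 2] (f : MvPolynomial (Fin 5) k) (hf : f = X 4 ^ 2 + X 0 ^ 6 * X 4 + X 1 ^ 3 + X 2 ^ 3 + X 3 ^ 3)
    (v : Spec (.of (MvPolynomial (Fin 5) k ⧸ Ideal.span {f})))
    (hv : v.asIdeal = Ideal.span (Set.range (fun j : Fin 5 => Ideal.Quotient.mk (Ideal.span {f}) (X j))))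
    (S' : Scheme.{0}) (g : S' ⟶ Spec ((Spec (.of (MvPolynomial (Fin 5) k ⧸ Ideal.span {f}))).presheaf.stalk v))
    (hg : IsBlowup g ((affineBlowup.idealSheaf (Ideal.span (Set.range (fun j : Fin 5 => Ideal.Quotient.mk (Ideal.span {f}) (X j))))).comap ((Spec (.of (MvPolynomial (Fin 5) k ⧸ Ideal.span {f}))).fromSpecStalk v))) :
    ∃ n : ℕ, IntrinsicTower.Recipes.RecipeTowerFull c 2 n S' := by
  haveI := Lx6c3Specimen.isIntegral_lx6c3 k f hf
  obtain ⟨h1, h2, h3, h4⟩ := pointFloor_lx6c3_input_legal k f hf v hv S' g hg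
  exact hTT 4 le_rfl 2 Nat.prime_two k (Spec (.of (MvPolynomial (Fin 5) k ⧸ Ideal.span {f})))
    (Spec.map (CommRingCat.ofHom (algebraMap k (MvPolynomial (Fin 5) k ⧸ Ideal.span {f}))))
    (FermatCubicConeGerm.structureMorphism_isSeparated k f) (FermatCubicConeGerm.structureMorphism_locallyOfFiniteType k f)
    (FermatCubicConeGerm.structureMorphism_quasiCompact k f) inferInstance v (Lx6c3Specimen.isClosed_vertex k f hf v hv)
    (Lx6c3Specimen.vertex_not_mem_regularLocus k f hf v hv) (Lx6c3Specimen.ringKrullDim_stalk_vertex k f hf v hv) S' g _ h1 h2 hg h3 h4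

/-- `TauTowerConjecture` (the statement OF RECORD), instantiated at the point floor of d4lx6c3. [OURS · instantiation of a candidate statement] -/
theorem tauTower_at_pointFloor (hTT : IntrinsicTower.Recipes.TauTowerConjecture) (k : Type) [Field k] [CharP k 2] (f : MvPolynomial (Fin 5) k) (hf : f = X 4 ^ 2 + X 0 ^ 6 * X 4 + X 1 ^ 3 + X 2 ^ 3 + X 3 ^ 3)
    (v : Spec (.of (MvPolynomial (Fin 5) k ⧸ Ideal.span {f})))
    (hv : v.asIdeal = Ideal.span (Set.range (fun j : Fin 5 => Ideal.Quotient.mk (Ideal.span {f}) (X j))))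
    (S' : Scheme.{0}) (g : S' ⟶ Spec ((Spec (.of (MvPolynomial (Fin 5) k ⧸ Ideal.span {f}))).presheaf.stalk v))
    (hg : IsBlowup g ((affineBlowup.idealSheaf (Ideal.span (Set.range (fun j : Fin 5 => Ideal.Quotient.mk (Ideal.span {f}) (X j))))).comap ((Spec (.of (MvPolynomial (Fin 5) k ⧸ Ideal.span {f}))).fromSpecStalk v))) :
    ∃ n : ℕ, IntrinsicTower.Recipes.RecipeTowerFull IntrinsicTower.Recipes.tauCentre 2 n S' :=
  recipeTowerFull_of_towerTerminates _ hTT k f hf v hv S' g hg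

/-- ★ **The candidate F-half `LocalFInjectivizationFibreAdmGe4` (taken as a hypothesis), instantiated at the point floor of d4lx6c3.**
[OURS · instantiation of a candidate statement] -/
theorem fHalf_at_pointFloor (h : LocalFullificationFibreAdmGe4Split.LocalFInjectivizationFibreAdmGe4) (k : Type) [Field k] [CharP k 2] (f : MvPolynomial (Fin 5) k) (hf : f = X 4 ^ 2 + X 0 ^ 6 * X 4 + X 1 ^ 3 + X 2 ^ 3 + X 3 ^ 3)
    (v : Spec (.of (MvPolynomial (Fin 5) k ⧸ Ideal.span {f})))
    (hv : v.asIdeal = Ideal.span (Set.range (fun j : Fin 5 => Ideal.Quotient.mk (Ideal.span {f}) (X j))))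
    (S' : Scheme.{0}) (g : S' ⟶ Spec ((Spec (.of (MvPolynomial (Fin 5) k ⧸ Ideal.span {f}))).presheaf.stalk v))
    (hg : IsBlowup g ((affineBlowup.idealSheaf (Ideal.span (Set.range (fun j : Fin 5 => Ideal.Quotient.mk (Ideal.span {f}) (X j))))).comap ((Spec (.of (MvPolynomial (Fin 5) k ⧸ Ideal.span {f}))).fromSpecStalk v))) :
    ∃ 𝓚 : S'.IdealSheafData, 𝓚 ≠ ⊥ ∧
      (∀ s ∈ (𝓚.support : Set S'), g.base s = closedPoint ((Spec (.of (MvPolynomial (Fin 5) k ⧸ Ideal.span {f}))).presheaf.stalk v)) ∧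
      ∀ (S'' : Scheme.{0}) (π : S'' ⟶ S'), IsBlowup π 𝓚 → ∀ s : S'', FullCl 2 (S''.presheaf.stalk s) := by
  haveI := Lx6c3Specimen.isIntegral_lx6c3 k f hf
  obtain ⟨h1, h2, h3, h4⟩ := pointFloor_lx6c3_input_legal k f hf v hv S' g hg
  exact h 4 le_rfl 2 Nat.prime_two k (Spec (.of (MvPolynomial (Fin 5) k ⧸ Ideal.span {f})))
    (Spec.map (CommRingCat.ofHom (algebraMap k (MvPolynomial (Fin 5) k ⧸ Ideal.span {f}))))
    (FermatCubicConeGerm.structureMorphism_isSeparated k f) (FermatCubicConeGerm.structureMorphism_locallyOfFiniteType k f)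
    (FermatCubicConeGerm.structureMorphism_quasiCompact k f) inferInstance v (Lx6c3Specimen.isClosed_vertex k f hf v hv)
    (Lx6c3Specimen.vertex_not_mem_regularLocus k f hf v hv) (Lx6c3Specimen.ringKrullDim_stalk_vertex k f hf v hv) S' g _ h1 h2 hg h3 h4

end Summit.ResolutionOfSingularities.ResolutionOfSingularities.Theorems.FInjectiveMacaulayfication.Lx6c3PointFloor

end
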